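import Literature.NumberTheory.EllipticCurves.PeriodIndexCorestrictionLocal
import Literature.NumberTheory.EllipticCurves.SelmerRestrictionCorankRelative
import Literature.NumberTheory.EllipticCurves.SubgroupSelmerProofs
import Literature.NumberTheory.EllipticCurves.IwasawaSelmerProofs
import Literature.NumberTheory.EllipticCurves.IwasawaSelmerControlCokerLemmas
import HarnessLib

/-!
# Corestriction on the Selmer groups over the fixed fields of open subgroups `A ≤ B ≤ Γ_K`, and on the
# layers `Sel_{p^∞}(E/K_{n+1}) → Sel_{p^∞}(E/K_n)` of a `ℤ_p`-extension (`res_∞ ∘ cores = Σ_{i<p} conj_{γ^{pⁿ i}} ∘ res_∞`)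

Generic continuous group cohomology plus the tree's subgroup model of Selmer groups (files `SubgroupSelmer`,
`IwasawaSelmer`), continuing `PeriodIndexCorestriction` / `PeriodIndexCorestrictionLocal` (corestriction
`coresH1 N hN : H¹(N, M) → H¹(G, M)` along an open subgroup of finite index of the AMBIENT group, `res ∘ cores = Nm`,
and Clark–Sharif's local triviality of `cores` via the double coset formula) and `SelmerRestrictionCorankRelative`
(the transport `H¹(A, M) ≃ H¹(A.subgroupOf B, M)`). For a topological group `G`, a discrete `G`-module `M` and
subgroups `A ≤ B ≤ G` with `A` open and of finite index in `B` this file provides, with complete proofs: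

* `coresOfLe M h hA : H¹(A, M) →+ H¹(B, M)` — the RELATIVE corestriction `cor_{B/A}` on the tree's model
  `Literature.NumberTheory.EllipticCurves.subgroupH1` (the transfer inside the group `B` along `A.subgroupOf B`,
  after the tautological identification `toSubgroupOfH1`); `resOfLe_coresOfLe_eq_sum`: for `A` normal,
  `res_{A ≤ B} ∘ cor_{B/A} = Σ_{x ∈ B/A} (s x)_*` for every system `s` of coset representatives;
  `coresOfLe_resOfLe`: `cor_{B/A} ∘ res = [B : A]`;
* `WeierstrassCurve.coresOfLe_mem_localKerOverOfEmb` / `WeierstrassCurve.coresOfLe_mem_selmerGroupOver` —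
  **corestriction maps `Sel_{p^∞}(E/K̄^A)` into `Sel_{p^∞}(E/K̄^B)`** (`A`, `B` open normal subgroups of
  `Γ_K`, `K` a number field): at every place and every embedding the local restriction of `cor t` vanishes by
  Clark–Sharif's local triviality of corestriction (`resH1Hom_coresH1_eq_zero`: `cor t` restricted to `B_E` is a sum
  of local corestrictions of the local restrictions of the conjugates `g_* t`, all zero for `t` Selmer);
* `WeierstrassCurve.coresLayer W p κ n : H¹(K_{n+1}, E[p^∞]) →+ H¹(K_n, E[p^∞])` — the corestriction between
  consecutive layers `κ.layerSubgroup (n+1) ≤ κ.layerSubgroup n` of a `ℤ_p`-extension `κ` (index `p`);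
  `layerToInfty_coresLayer`: **`res_{K_∞/K_n} ∘ cor_{K_{n+1}/K_n} = Σ_{i<p} conj_{γ^{pⁿ i}} ∘ res_{K_∞/K_{n+1}}`** for a
  topological generator `γ` (the cosets of `Gal(K̄/K_{n+1})` in `Gal(K̄/K_n)` are represented by `γ^{pⁿ i}`,
  `i < p`); `coresLayer_mem_selmerLayer`: `cor(Sel_{p^∞}(E/K_{n+1})) ⊆ Sel_{p^∞}(E/K_n)`;
  `coresLayer_resOfLe`: `cor ∘ res = p`.

These are the corestriction inputs of Hachimori–Matsuno's Cassels–Tate proof of Greenberg's Prop. 4.14 ("the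
dual of the restriction map `C_n → C_{n+1}` under this pairing is the corestriction map `C_{n+1} → C_n`", Proc. AMS
128 (2000) p. 2540, and `res ∘ cores =` norm in the final norm argument), as displayed by
`Summits/…/Theorems/ByReductionTypeAtTwoTowerNoFiniteSubmodule*` and by cell `bsd-potss`'
`QuadraticBranchSignedControlNoFiniteSubmoduleOfCasselsTatePairings`. Everything here is proved; no named fact
is introduced. Mathlib has no corestriction on continuous cohomology (the tree's is `PeriodIndexCorestriction`).

## References

* J.-P. Serre, *Galois Cohomology* (1997), I.§2.4 (Res, Cor, `Cor ∘ Res = n`), I.§2.5. [SerreGaloisCohomology1997]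
* J. Neukirch, A. Schmidt, K. Wingberg, *Cohomology of Number Fields*, 2nd ed. (2008), I.§5 (cor on cochains, double
  coset formula). [NeukirchSchmidtWingberg2008]
* P. L. Clark, S. Sharif, Algebra & Number Theory 4 (2010), §3.6 (corestriction preserves local triviality).
  [ClarkSharif2010]
* Y. Hachimori, K. Matsuno, Proc. AMS 128 (2000) 2539–2541, proof of the Theorem (p. 2540). [HachimoriMatsuno2000]
* L. C. Washington, *Introduction to Cyclotomic Fields*, §13.1 (`Gal(K_∞/K_n) = Γ^{pⁿ}`, generated by `γ^{pⁿ}`).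
  [Washington1997]
-/

noncomputable section

open scoped Classical

universe u

namespace Literature.NumberTheory.EllipticCurves

open GaloisRepresentations

/-! ## §1 The relative corestriction `cor_{B/A} : H¹(A, M) → H¹(B, M)` -/

section Generic

variable {G : Type u} [Group G] [TopologicalSpace G] [IsTopologicalGroup G]
variable {A B : Subgroup G}
variable (M : Type u) [AddCommGroup M] [DistribMulAction G M] [TopologicalSpace M] [DiscreteTopology M]

/-- **Relative corestriction** `cor_{B/A} : H¹(A, M) →+ H¹(B, M)` for subgroups `A ≤ B` of a topological group `G`
with `A` open and of finite index in `B` (finite index as the instance argument `[Fintype (B ⧸ A.subgroupOf B)]`,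
cf. `PeriodIndexCorestriction`): the corestriction of the group `B` along its open subgroup `A.subgroupOf B`
(`coresH1`), precomposed with the tautological transport `H¹(A, M) → H¹(A.subgroupOf B, M)` (`toSubgroupOfH1`). For
`G = Γ_K`, `B = Gal(K̄/F) ≥ A = Gal(K̄/F')` this is `Cor_{F'/F} : H¹(F', M) → H¹(F, M)`.
Serre, *Galois Cohomology*, I.§2.4; Neukirch–Schmidt–Wingberg, I.§5. [cite: SerreGaloisCohomology1997, I.§2.4 (Cor)] -/
def coresOfLe (hA : IsOpen (A : Set G)) [Fintype (B ⧸ A.subgroupOf B)] :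
    subgroupH1 A M →+ subgroupH1 B M :=
  (coresH1 (A.subgroupOf B) (Literature.NumberTheory.EllipticCurves.isOpen_subgroupOf (B := B) hA)).comp
    (toSubgroupOfH1 A B M)

/-- Unfolding `coresOfLe`: the corestriction of Serre, *Galois Cohomology*, I.§2.4, computed inside `B`.
[cite: SerreGaloisCohomology1997, I.§2.4 (Cor)] -/
theorem coresOfLe_apply (hA : IsOpen (A : Set G)) [Fintype (B ⧸ A.subgroupOf B)] (y : subgroupH1 A M) :
    coresOfLe (B := B) M hA y =
      coresH1 (A.subgroupOf B) (Literature.NumberTheory.EllipticCurves.isOpen_subgroupOf (B := B) hA)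
        (toSubgroupOfH1 A B M y) :=
  rfl

/-- `toSubgroupOfH1` is injective (it has the left inverse `ofSubgroupOfH1`). [folklore] -/
private theorem toSubgroupOfH1_injective (h : A ≤ B) : Function.Injective (toSubgroupOfH1 A B M) :=
  Function.LeftInverse.injective (g := ofSubgroupOfH1 M h) fun y ↦ ofSubgroupOfH1_toSubgroupOfH1 M h y

/-- **`cor_{B/A} ∘ res_{A ≤ B} = [B : A]`** on `H¹(B, M)` (`cor ∘ res` inside `B`, `coresH1_resSubgroupH1`).
Serre, *Galois Cohomology*, I.§2.4, Prop. 9. [cite: SerreGaloisCohomology1997, I.§2.4 Prop. 9 (Cor ∘ Res = n)] -/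
theorem coresOfLe_resOfLe (h : A ≤ B) (hA : IsOpen (A : Set G)) [Fintype (B ⧸ A.subgroupOf B)]
    (x : subgroupH1 B M) :
    coresOfLe M hA (resOfLe M h x) = Fintype.card (B ⧸ A.subgroupOf B) • x := by
  rw [coresOfLe_apply, ← resSubgroupH1_subgroupOf_eq M h, coresH1_resSubgroupH1]

variable [A.Normal]

/-- **`res_{A ≤ B} ∘ cor_{B/A} = Σ_{x ∈ B/A} (s x)_*`** for `A` normal and EVERY system `s` of left coset
representatives of `A.subgroupOf B` in `B`: the restriction to `A` of the corestriction of `y ∈ H¹(A, M)` is the sum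
of the conjugates `conjH1 A M (s x) y` (the norm of `B/A`). Transport of `resSubgroupH1_coresH1` (`res ∘ cores = Nm`
inside `B`) along `A.subgroupOf B ≅ A` (`resSubgroupH1_subgroupOf_eq`, `conjH1_toSubgroupOfH1`).
Serre, *Local Fields*, VII.§5 and VII.§7; Neukirch–Schmidt–Wingberg, I.§5 (double coset formula with `N` normal);
Clark–Sharif 2010, Lemma 15 ("`res ∘ cores θ = Nm θ`"). [cite: ClarkSharif2010, Lemma 15] [cite: NeukirchSchmidtWingberg2008, I.§5] -/
theorem resOfLe_coresOfLe_eq_sum (h : A ≤ B) (hA : IsOpen (A : Set G)) [Fintype (B ⧸ A.subgroupOf B)]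
    {s : B ⧸ A.subgroupOf B → B} (hs : ∀ x, (s x : B ⧸ A.subgroupOf B) = x) (y : subgroupH1 A M) :
    resOfLe M h (coresOfLe M hA y) = ∑ x : B ⧸ A.subgroupOf B, conjH1 A M (s x : G) y := by
  apply toSubgroupOfH1_injective M h
  rw [← resSubgroupH1_subgroupOf_eq M h, coresOfLe_apply, resSubgroupH1_coresH1 _ _ hs, map_sum]
  exact Finset.sum_congr rfl fun x _ ↦ conjH1_toSubgroupOfH1 M (s x) y

end Generic

end Literature.NumberTheory.EllipticCurves

/-! ## §2 Corestriction preserves the Selmer groups over `K̄^A ⊆ K̄^B` -/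

namespace WeierstrassCurve

open Literature.NumberTheory.EllipticCurves Literature.NumberTheory.GaloisRepresentations

variable {K : Type u} [Field K] (W : WeierstrassCurve K) (p : ℕ)
variable {A B : Subgroup (Field.absoluteGaloisGroup K)} [A.Normal]

section Local

variable {E : Type u} [Field E] [Algebra K E] (ι : AlgebraicClosure K →ₐ[K] AlgebraicClosure E)

/-- **Corestriction preserves the local kernels, embedding by embedding** (Clark–Sharif 2010, §3.6: "the
corestriction map induces a homomorphism `⊕_{w ∣ v} H¹((K_P)_w, E) → H¹(K_v, E)`"). For `A ≤ B ≤ Γ_K` with `A` normal,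
open, of finite index in `B`, a `K`-embedding `ι : K̄ → K̄_E` and `t ∈ H¹(A, E[p^∞])`: if every conjugate `g_* t`,
`g ∈ B`, dies in `H¹(A_ι, E(K̄_E))` (the local condition at every place of `K̄^A` above the place of `K̄^B` singled out by
`ι`), then `cor_{B/A} t` dies in `H¹(B_ι, E(K̄_E))`. Proof: Clark–Sharif's `resH1Hom_coresH1_eq_zero` inside the group
`B` (subgroup `A.subgroupOf B`, local group `B_ι`, compatible pair `(resGalSubgroupOfEmb B ι, ι_*)`), the hypothesis
being transported along `(A.subgroupOf B)_{ι} ≅ A_ι` by functoriality of `resH1Hom`.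
[cite: ClarkSharif2010, §3.6 (last paragraph)] -/
theorem coresOfLe_mem_localKerOverOfEmb (hA : IsOpen (A : Set (Field.absoluteGaloisGroup K)))
    [Fintype (B ⧸ A.subgroupOf B)] {t : W.subgroupH1 p A}
    (ht : ∀ g : B, W.conjH1 p A (g : Field.absoluteGaloisGroup K) t ∈ W.localKerOverOfEmb p A ι) :
    coresOfLe (B := B) (geomPrimaryTorsion W p) hA t ∈ W.localKerOverOfEmb p B ι := by
  -- the group `B`, its open normal subgroup `A ∩ B`, the local group `B_ι` mapping to `B` by `φ = resGal`
  have hψ := W.pointsMapOfEmb_comp_subtype_smul p ι B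
  haveI : Fintype (localSubgroupOfEmb B ι ⧸ (A.subgroupOf B).comap
      ((resGalSubgroupOfEmb B ι : localSubgroupOfEmb B ι →ₜ* B) : localSubgroupOfEmb B ι →* B)) :=
    haveI := finite_quotientComap (A.subgroupOf B)
      ((resGalSubgroupOfEmb B ι : localSubgroupOfEmb B ι →ₜ* B) : localSubgroupOfEmb B ι →* B)
    Fintype.ofFinite _
  rw [localKerOverOfEmb, AddMonoidHom.mem_ker, localResOverOfEmb_eq, coresOfLe_apply]
  refine resH1Hom_coresH1_eq_zero (A.subgroupOf B) (resGalSubgroupOfEmb B ι)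
    ((pointsMapOfEmb W ι).comp (geomPrimaryTorsion W p).subtype) hψ _ _ fun g ↦ ?_
  rw [conjH1_toSubgroupOfH1]
  -- transport of the hypothesis along `(A.subgroupOf B).comap φ ≅ A_ι`
  let e : ((A.subgroupOf B).comap
      ((resGalSubgroupOfEmb B ι : localSubgroupOfEmb B ι →ₜ* B) : localSubgroupOfEmb B ι →* B)) →ₜ*
        localSubgroupOfEmb A ι :=
    { toFun := fun d ↦ ⟨((d : localSubgroupOfEmb B ι) : Field.absoluteGaloisGroup E),
        Subgroup.mem_subgroupOf.mp (Subgroup.mem_comap.mp d.2)⟩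
      map_one' := rfl
      map_mul' := fun _ _ ↦ rfl
      continuous_toFun := (continuous_subtype_val.comp continuous_subtype_val).subtype_mk _ }
  have key : resH1Hom (comapRestrict (A.subgroupOf B) (resGalSubgroupOfEmb B ι))
      ((pointsMapOfEmb W ι).comp (geomPrimaryTorsion W p).subtype)
      (smul_compat_comapRestrict (A.subgroupOf B) (resGalSubgroupOfEmb B ι) _ hψ)
      (toSubgroupOfH1 A B (geomPrimaryTorsion W p) (W.conjH1 p A (g : Field.absoluteGaloisGroup K) t)) =
      Literature.NumberTheory.EllipticCurves.resH1Hom e (AddMonoidHom.id (localPoints W E)) (fun _ _ ↦ rfl)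
        (W.localResOverOfEmb p A ι (W.conjH1 p A (g : Field.absoluteGaloisGroup K) t)) := by
    rw [toSubgroupOfH1, localResOverOfEmb_eq, resH1Hom_resH1Hom, resH1Hom_resH1Hom]
    exact DFunLike.congr_fun (resH1Hom_congr (by ext; rfl) (by ext; rfl) _ _) _
  have h0 : W.localResOverOfEmb p A ι (W.conjH1 p A (g : Field.absoluteGaloisGroup K) t) = 0 := ht g
  rw [key, h0, map_zero]

end Local

variable [NumberField K] [B.Normal]

/-- **Corestriction maps `Sel_{p^∞}(E/K̄^A)` into `Sel_{p^∞}(E/K̄^B)`** for open normal subgroups `A ≤ B` of `Γ_K`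
(`A` of finite index in `B`): `cor_{B/A}(Sel_{p^∞}(E/F')) ⊆ Sel_{p^∞}(E/F)` for `F = K̄^B ⊆ F' = K̄^A`. At a place `v` of
`K` and `σ ∈ Γ_K`, the condition "`conj_σ (cor t)` dies at the chosen place above `v`" is "`cor t` dies at the
place singled out by the embedding `closureEmb ∘ σ`" (`localKerOverOfEmb_comp`), and at EVERY embedding `cor t` dies
by `coresOfLe_mem_localKerOverOfEmb`, the conjugates `g_* t` (`g ∈ B`) being Selmer again
(`map_conjH1_selmerGroupOver_le_holds`) and a Selmer class dying at every embedding
(`exists_localKerOverOfEmb_eq_comap_holds`). Milne, *ADT*, I §6; Neukirch–Schmidt–Wingberg, I.§5.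
[cite: ClarkSharif2010, §3.6 (last paragraph)] -/
theorem coresOfLe_mem_selmerGroupOver (hA : IsOpen (A : Set (Field.absoluteGaloisGroup K)))
    [Fintype (B ⧸ A.subgroupOf B)] {t : W.subgroupH1 p A} (ht : t ∈ W.selmerGroupOver p A) :
    coresOfLe (B := B) (geomPrimaryTorsion W p) hA t ∈ W.selmerGroupOver p B := by
  -- at a completion `E` where every Selmer class over `K̄^A` satisfies the local condition at every conjugate,
  -- `cor t` satisfies the local condition over `K̄^B` at every conjugate
  have hcomp : ∀ {E : Type u} [Field E] [Algebra K E],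
      (∀ t' ∈ W.selmerGroupOver p A, ∀ σ : Field.absoluteGaloisGroup K, W.conjH1 p A σ t' ∈ W.localKerOver p A E) →
      ∀ σ : Field.absoluteGaloisGroup K,
        W.conjH1 p B σ (coresOfLe (B := B) (geomPrimaryTorsion W p) hA t) ∈ W.localKerOver p B E := by
    intro E _ _ hloc σ
    -- the conjugates `g_* t`, `g ∈ B`, are Selmer, hence die at every embedding `ι`
    have hSel : ∀ (ι : AlgebraicClosure K →ₐ[K] AlgebraicClosure E) (g : B),
        W.conjH1 p A (g : Field.absoluteGaloisGroup K) t ∈ W.localKerOverOfEmb p A ι := by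
      intro ι g
      have hgt : W.conjH1 p A (g : Field.absoluteGaloisGroup K) t ∈ W.selmerGroupOver p A :=
        W.map_conjH1_selmerGroupOver_le_holds p A (g : Field.absoluteGaloisGroup K) ⟨t, ht, rfl⟩
      obtain ⟨τ, hτ⟩ := W.exists_localKerOverOfEmb_eq_comap_holds p A ι
      rw [hτ, AddSubgroup.mem_comap]
      exact hloc _ hgt τ
    have hmem := W.coresOfLe_mem_localKerOverOfEmb p
      ((closureEmb (K := K) E).comp ((show AlgebraicClosure K ≃ₐ[K] AlgebraicClosure K from σ) :
        AlgebraicClosure K →ₐ[K] AlgebraicClosure K)) hA (hSel _)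
    rw [W.localKerOverOfEmb_comp p B (closureEmb (K := K) E), AddSubgroup.mem_comap] at hmem
    rw [localKerOver_eq_ofEmb]
    exact hmem
  rw [mem_selmerGroupOver_iff]
  exact ⟨fun v σ ↦ hcomp (fun t' ht' τ ↦ ((W.mem_selmerGroupOver_iff p A t').mp ht').1 v τ) σ,
    fun w σ ↦ hcomp (fun t' ht' τ ↦ ((W.mem_selmerGroupOver_iff p A t').mp ht').2 w τ) σ⟩

/-! ## §3 The layers of a `ℤ_p`-extension: `cor_{K_{n+1}/K_n}` and `res_∞ ∘ cor = Σ_{i<p} conj_{γ^{pⁿ i}} ∘ res_∞` -/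

end WeierstrassCurve

namespace Literature.NumberTheory.EllipticCurves.ZpExtension

variable {K : Type u} [Field K] {p : ℕ} [Fact p.Prime] (κ : ZpExtension K p) {γ : Field.absoluteGaloisGroup K}

/-- `Gal(K̄/K_{n+1})` has index `p` in `Gal(K̄/K_n)` (`[K_{n+1} : K_n] = p`). Washington, *Introduction to Cyclotomic
Fields*, §13.1. [cite: Washington1997, §13.1 (the layers `K_n` of a `ℤ_p`-extension, `[K_n : K] = pⁿ`)] -/
theorem relIndex_layerSubgroup_succ (n : ℕ) :
    (κ.layerSubgroup (n + 1)).relIndex (κ.layerSubgroup n) = p := by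
  have h := Subgroup.relIndex_mul_index (κ.layerSubgroup_antitone (Nat.le_succ n))
  rw [κ.index_layerSubgroup, κ.index_layerSubgroup, pow_succ, mul_comm (p ^ n)] at h
  exact mul_right_cancel₀ (pow_ne_zero n (Fact.out : p.Prime).ne_zero) h

/-- `Gal(K̄/K_{n+1})` has finite index in `Gal(K̄/K_n)` (index `p`). [folklore] -/
private theorem finiteIndex_layerSubgroup_succ (n : ℕ) :
    ((κ.layerSubgroup (n + 1)).subgroupOf (κ.layerSubgroup n)).FiniteIndex :=
  ⟨fun h0 ↦ (Fact.out : p.Prime).ne_zero ((κ.relIndex_layerSubgroup_succ n).symm.trans h0)⟩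

/-- `Gal(K̄/K_n) / Gal(K̄/K_{n+1})` is finite (order `p`). Washington, §13.1.
[cite: Washington1997, §13.1 (the layers `K_n` of a `ℤ_p`-extension, `[K_n : K] = pⁿ`)] -/
theorem finite_layerQuotient_succ (n : ℕ) :
    Finite (κ.layerSubgroup n ⧸ (κ.layerSubgroup (n + 1)).subgroupOf (κ.layerSubgroup n)) :=
  haveI := κ.finiteIndex_layerSubgroup_succ n
  inferInstance

/-- The representative `γ^{pⁿ i} = (γ^{pⁿ})^i ∈ Gal(K̄/K_n)` (`κ γ = 1`) of a coset of `Gal(K̄/K_{n+1})` (plumbing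
definition for `bijective_layerCosetRep`). Washington, §13.1. [folklore] -/
def layerCosetRep (hγ : κ.IsTopGenerator γ) (n : ℕ) (i : ℕ) : κ.layerSubgroup n :=
  ⟨(γ ^ p ^ n) ^ i, Subgroup.pow_mem _ (κ.pow_mem_layerSubgroup hγ n) _⟩

/-- Values of `layerCosetRep`. [folklore] -/
@[simp]
private theorem layerCosetRep_coe (hγ : κ.IsTopGenerator γ) (n i : ℕ) :
    ((κ.layerCosetRep hγ n i : κ.layerSubgroup n) : Field.absoluteGaloisGroup K) = (γ ^ p ^ n) ^ i :=
  rfl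

/-- The cosets of `Gal(K̄/K_{n+1})` in `Gal(K̄/K_n)` are represented, bijectively, by `γ^{pⁿ i} = (γ^{pⁿ})^i`, `i < p`,
for a topological generator `γ` (`κ γ = 1`): two of them are congruent modulo `κ⁻¹(p^{n+1}ℤ_p)` only if `p ∣ i − j`
(`pow_dvd_of_mem_layerSubgroup`), and the index is `p`. Washington, §13.1 (`Gal(K_∞/K_n) = Γ^{pⁿ}` is topologically
generated by `γ^{pⁿ}`, so `Gal(K_{n+1}/K_n)` is cyclic of order `p` generated by its image).
[cite: Washington1997, §13.1 (`Γ_n = Γ^{pⁿ}`, `Gal(K_n/K) ≃ ℤ/pⁿℤ`)] -/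
theorem bijective_layerCosetRep (hγ : κ.IsTopGenerator γ) (n : ℕ) :
    Function.Bijective fun i : Fin p ↦
      ((κ.layerCosetRep hγ n i : κ.layerSubgroup n) :
        κ.layerSubgroup n ⧸ (κ.layerSubgroup (n + 1)).subgroupOf (κ.layerSubgroup n)) := by
  haveI := κ.finite_layerQuotient_succ n
  haveI : Fintype (κ.layerSubgroup n ⧸ (κ.layerSubgroup (n + 1)).subgroupOf (κ.layerSubgroup n)) :=
    Fintype.ofFinite _
  rw [Fintype.bijective_iff_injective_and_card, Fintype.card_fin, Fintype.card_eq_nat_card,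
    ← Subgroup.index_eq_card]
  refine ⟨fun i j hij ↦ ?_, (κ.relIndex_layerSubgroup_succ n).symm⟩
  -- `(γ^{pⁿ})^{-a} (γ^{pⁿ})^{b} ∈ Gal(K̄/K_{n+1})` forces `p ∣ b - a`
  have hmem : ∀ {a b : ℕ}, a ≤ b →
      ((κ.layerCosetRep hγ n a : κ.layerSubgroup n) :
        κ.layerSubgroup n ⧸ (κ.layerSubgroup (n + 1)).subgroupOf (κ.layerSubgroup n)) =
      ((κ.layerCosetRep hγ n b : κ.layerSubgroup n) :
        κ.layerSubgroup n ⧸ (κ.layerSubgroup (n + 1)).subgroupOf (κ.layerSubgroup n)) → p ∣ b - a := by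
    intro a b hab hq
    rw [QuotientGroup.eq, Subgroup.mem_subgroupOf, Subgroup.coe_mul, Subgroup.coe_inv, layerCosetRep_coe,
      layerCosetRep_coe, ← pow_mul_pow_sub (γ ^ p ^ n) hab, inv_mul_cancel_left] at hq
    have h1 := κ.pow_dvd_of_mem_layerSubgroup hγ n 1 (b - a) κ.kerSubgroup.one_mem (by rwa [mul_one])
    rwa [pow_one] at h1
  apply Fin.ext
  rcases le_total (i : ℕ) j with hle | hle
  · have hd := hmem hle hij
    have : (j : ℕ) - i = 0 := Nat.eq_zero_of_dvd_of_lt hd (by omega)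
    omega
  · have hd := hmem hle hij.symm
    have : (i : ℕ) - j = 0 := Nat.eq_zero_of_dvd_of_lt hd (by omega)
    omega

end Literature.NumberTheory.EllipticCurves.ZpExtension

namespace WeierstrassCurve

open Literature.NumberTheory.EllipticCurves Literature.NumberTheory.GaloisRepresentations

section Layers

variable {K : Type u} [Field K] (W : WeierstrassCurve K) (p : ℕ) [Fact p.Prime] (κ : ZpExtension K p)
  {γ : Field.absoluteGaloisGroup K}

/-- **The corestriction `cor_{K_{n+1}/K_n} : H¹(K_{n+1}, E[p^∞]) →+ H¹(K_n, E[p^∞])`** between consecutive layers of a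
`ℤ_p`-extension `κ` (`coresOfLe` along `κ.layerSubgroup (n+1) ≤ κ.layerSubgroup n`, open of index `p`). Hachimori–Matsuno
(2000), p. 2540 (the corestriction maps `C_{n+1} → C_n`); Serre, *Galois Cohomology*, I.§2.4.
[cite: HachimoriMatsuno2000, proof of the Theorem (p. 2540: "the corestriction map `C_{n+1} → C_n`")] -/
def coresLayer (n : ℕ) : W.subgroupH1 p (κ.layerSubgroup (n + 1)) →+ W.subgroupH1 p (κ.layerSubgroup n) :=
  haveI := κ.finite_layerQuotient_succ n
  haveI : Fintype (κ.layerSubgroup n ⧸ (κ.layerSubgroup (n + 1)).subgroupOf (κ.layerSubgroup n)) :=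
    Fintype.ofFinite _
  coresOfLe (B := κ.layerSubgroup n) (geomPrimaryTorsion W p) (κ.isOpen_layerSubgroup (n + 1))

/-- **`cor_{K_{n+1}/K_n}(Sel_{p^∞}(E/K_{n+1})) ⊆ Sel_{p^∞}(E/K_n)`** (`coresOfLe_mem_selmerGroupOver` for the layers).
Hachimori–Matsuno (2000), p. 2540. [cite: ClarkSharif2010, §3.6 (last paragraph)] -/
theorem coresLayer_mem_selmerLayer [NumberField K] (n : ℕ) {t : W.subgroupH1 p (κ.layerSubgroup (n + 1))}
    (ht : t ∈ W.selmerLayer κ (n + 1)) : W.coresLayer p κ n t ∈ W.selmerLayer κ n := by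
  letI := κ.finite_layerQuotient_succ n
  letI : Fintype (κ.layerSubgroup n ⧸ (κ.layerSubgroup (n + 1)).subgroupOf (κ.layerSubgroup n)) :=
    Fintype.ofFinite _
  exact W.coresOfLe_mem_selmerGroupOver p _ ht

/-- **`cor_{K_{n+1}/K_n} ∘ res_{K_{n+1}/K_n} = p`** on `H¹(K_n, E[p^∞])` (`[K_{n+1} : K_n] = p`). Serre, *Galois Cohomology*,
I.§2.4, Prop. 9. [cite: SerreGaloisCohomology1997, I.§2.4 Prop. 9 (Cor ∘ Res = n)] -/
theorem coresLayer_resOfLe (n : ℕ) (x : W.subgroupH1 p (κ.layerSubgroup n)) :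
    W.coresLayer p κ n (W.resOfLe p (κ.layerSubgroup_antitone (Nat.le_succ n)) x) = p • x := by
  letI := κ.finite_layerQuotient_succ n
  letI : Fintype (κ.layerSubgroup n ⧸ (κ.layerSubgroup (n + 1)).subgroupOf (κ.layerSubgroup n)) :=
    Fintype.ofFinite _
  have hi : Fintype.card (κ.layerSubgroup n ⧸ (κ.layerSubgroup (n + 1)).subgroupOf (κ.layerSubgroup n)) = p := by
    rw [Fintype.card_eq_nat_card, ← Subgroup.index_eq_card]
    exact κ.relIndex_layerSubgroup_succ n
  have h := coresOfLe_resOfLe (geomPrimaryTorsion W p) (κ.layerSubgroup_antitone (Nat.le_succ n))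
    (κ.isOpen_layerSubgroup (n + 1)) x
  rw [hi] at h
  exact h

/-- **`res_{K_∞/K_n} ∘ cor_{K_{n+1}/K_n} = Σ_{i<p} conj_{γ^{pⁿ i}} ∘ res_{K_∞/K_{n+1}}`** on `H¹(K_{n+1}, E[p^∞])`, for a
topological generator `γ` of the `ℤ_p`-extension: `res ∘ cores` is the norm of `Gal(K_{n+1}/K_n) = ⟨γ^{pⁿ}⟩` (order `p`;
`resOfLe_coresOfLe_eq_sum` with the representatives `γ^{pⁿ i}`, `bijective_layerCosetRep`), followed by restriction to
`K_∞`, which commutes with conjugation (`resOfLe_comp_conjH1`). This is the shape of the corestriction input of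
Hachimori–Matsuno's norm argument (pp. 2540–2541). [cite: HachimoriMatsuno2000, proof of the Theorem (pp. 2540–2541)] -/
theorem layerToInfty_coresLayer (hγ : κ.IsTopGenerator γ) (n : ℕ)
    (t : W.subgroupH1 p (κ.layerSubgroup (n + 1))) :
    W.layerToInfty κ n (W.coresLayer p κ n t) =
      ∑ i ∈ Finset.range p, W.conjH1 p κ.kerSubgroup (γ ^ (p ^ n * i)) (W.layerToInfty κ (n + 1) t) := by
  letI := κ.finite_layerQuotient_succ n
  letI : Fintype (κ.layerSubgroup n ⧸ (κ.layerSubgroup (n + 1)).subgroupOf (κ.layerSubgroup n)) :=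
    Fintype.ofFinite _
  -- representatives `γ^{pⁿ i}`, `i < p`
  let e := Equiv.ofBijective _ (κ.bijective_layerCosetRep hγ n)
  have hs : ∀ x, ((κ.layerCosetRep hγ n (e.symm x : Fin p) : κ.layerSubgroup n) :
      κ.layerSubgroup n ⧸ (κ.layerSubgroup (n + 1)).subgroupOf (κ.layerSubgroup n)) = x :=
    fun x ↦ e.apply_symm_apply x
  have h1 : W.layerToInfty κ n (W.coresLayer p κ n t) = W.resOfLe p (κ.kerSubgroup_le_layerSubgroup (n + 1))
      (W.resOfLe p (κ.layerSubgroup_antitone (Nat.le_succ n)) (W.coresLayer p κ n t)) :=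
    (congrArg (fun f ↦ f (W.coresLayer p κ n t))
      (W.resOfLe_comp_holds p (κ.kerSubgroup_le_layerSubgroup (n + 1)) (κ.layerSubgroup_antitone (Nat.le_succ n)))).symm
  have h2 : W.resOfLe p (κ.layerSubgroup_antitone (Nat.le_succ n)) (W.coresLayer p κ n t) =
      ∑ x, W.conjH1 p (κ.layerSubgroup (n + 1))
        ((κ.layerCosetRep hγ n (e.symm x : Fin p) : κ.layerSubgroup n) : Field.absoluteGaloisGroup K) t :=
    resOfLe_coresOfLe_eq_sum (geomPrimaryTorsion W p) (κ.layerSubgroup_antitone (Nat.le_succ n))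
      (κ.isOpen_layerSubgroup (n + 1)) hs t
  have h3 : ∀ i : ℕ, W.resOfLe p (κ.kerSubgroup_le_layerSubgroup (n + 1))
      (W.conjH1 p (κ.layerSubgroup (n + 1)) ((γ ^ p ^ n) ^ i) t) =
      W.conjH1 p κ.kerSubgroup (γ ^ (p ^ n * i)) (W.layerToInfty κ (n + 1) t) := fun i ↦ by
    rw [pow_mul]
    exact congrArg (fun f ↦ f t)
      (resOfLe_comp_conjH1_holds (M := geomPrimaryTorsion W p) (κ.kerSubgroup_le_layerSubgroup (n + 1))
        ((γ ^ p ^ n) ^ i))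
  rw [h1, h2, map_sum]
  simp only [ZpExtension.layerCosetRep_coe, h3]
  rw [e.symm.sum_comp (fun i : Fin p ↦ W.conjH1 p κ.kerSubgroup (γ ^ (p ^ n * (i : ℕ))) (W.layerToInfty κ (n + 1) t)),
    Fin.sum_univ_eq_sum_range (fun i ↦ W.conjH1 p κ.kerSubgroup (γ ^ (p ^ n * i)) (W.layerToInfty κ (n + 1) t))]

end Layers

end WeierstrassCurve

end
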